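/-
Copyright (c) 2026 the pub-hodgecm-mathlib formalisation cell (harness21).  Prover seat hodgecm-mathlib-LH4-p10 (g9), Track B ∕ R90-TF, h413 = `stmt-HodgeConjecture-24833`,
R90-TF section S8 «ContSpec-n½» (S8 dealer R90-CS-plan (g3) S8-R245 (b), ruling J-S8-W1): the PAYER of (hstab) for REGULAR data — right `K_∞`-averaging (the pointwise `K`-type
projector `e_τ`, or any compactly supported continuous weight) PRESERVES the admissible data of ★ D1 `resGMidAtomGen`: the section stays in its pair-section space and continuous, the
continued family stays holomorphic on the slit half-plane and IS the Eisenstein family of the averaged section on `{2 < Re}`, and the pole letter at `3∕2` averages — hypothesis-first on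
ESTATE T's regularity exports `hE4` (continuity of `Ec z`) and `hEbd` (joint local bound).  Consumer: R90-CS-p03 (g4) `hW1_of_tauStable` (the hW1 road, (R)′ :337 ∕ (V♭) :406).
-/
import Summits.HodgeConjecture.HodgeConjecture.Theorems.R90S8ResidueConstantTermOfExportsU3     -- ★ p864590 CT-RES (K2E1-p10): `differentiableOn_midPoleExtension`, `norm_midPoleExtension_le`, `exists_uniform_bound_of_locally_bounded`, `continuous_midPoleLetter_apply`
import Summits.HodgeConjecture.HodgeConjecture.Theorems.R90S8ResidueOperatorEquivarianceU3     -- ★ p864700 (this seat): `reSlit_mem_nhdsNE_three_halves`; brings ★ `hSUM_of_unitary`, ★ pair DEFS, ★ `Literature.Analysis.Complex.differentiableOn_integral_of_dominated`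
import Summits.HodgeConjecture.HodgeConjecture.Theorems.K2E1BorelEisensteinGodementCMThree       -- ★ `exists_locallyUniform_majorant_flatSectionU_cm_three` (Godement majorant, locally uniform); brings ★ `countable_borelQuotient`
import Summits.HodgeConjecture.HodgeConjecture.Theorems.R90S8TubeSeedOperatorLettersU3           -- ★ (K2E2-p12): `exists_bound_of_mem_chiSectionSpacePair_midBlock` (D1's sections are bounded, `μω` unitary)
import Mathlib.MeasureTheory.Integral.Bochner.Set                                                -- Mathlib `continuous_parametric_integral_of_continuous`
import HarnessLib

/-!
# S8 (hstab) payer — `R90S8ResGMidAtomGenKTypeProjectionU3`: RIGHT `K_∞`-AVERAGING PRESERVES ADMISSIBLE RESIDUE DATA (`e_τ φ`, `e_τ ∘ Ec`, `Sp`, `e_τ ∘ Fp`)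

Track B ∕ R90-TF, crux h413 = `stmt-HodgeConjecture-24833`, route of record `HCCMUnconditional`; cell `hodgecm-mathlib`, R90-TF section S8 «ContSpec-n½ ∕ ResidualSpectrum», the hW1 road
(«`resGMidBlock ≤ resGMidBlockτ`», CS-p03 (g4)): (hstab) = «averaging an admissible D1 datum along `K_∞` gives an admissible datum» + (hPW) Peter–Weyl.  THEOREMS ONLY (no `def`, no
`instance`, no `notation`, no named-fact hypothesis, no `sorry`; default heartbeats); lane `--supports stmt-HodgeConjecture-24833 --as helper` (count-neutral).  CLOSES NO SOCKET.

THE MATHEMATICS ([MoeglinWaldspurger1995] I.2.17, II.1.5–II.1.7, IV.1.9–IV.1.11; [BorelJacquet1979] §1.3, §4.1; [Conway1978] IV §3, §5).  Let `(P F)(x) := ∫_K c(k)·F(x·ι(k)) dμ_K(k)` be the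
right average of a function `F` on `G(𝔸)` along a continuous map `ι : K → G(𝔸)` from a COMPACT parameter space with a finite measure and a continuous weight `c` (the case of record:
`K = ι(K_∞)`, `μ_K` Haar probability, `c = d_τ·conj χ_τ` — the `K`-type projector `e_τ`).  If the heights do not see `ι(K)` (`H(x·ι k) = H(x)`, ★ `borelHeight_mul_coe_archMaximalCompact`)
and the level `K′` commutes with `ι(K)` (★ `commute_tauLevel_archMaximalCompact` at τ-levels), then: (c1) `P` maps the pair-section space `V(χ₁,χ₂;K′,ω)` to itself (the laws are
pointwise); (c2) `P φ` is continuous (compact parametric integral); (c4) for a family `Ec` holomorphic on an open `U` with T's regularity (`Ec z` continuous, joint local bound) the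
averaged family `z ↦ P(Ec z)(g)` is holomorphic on `U` (dominated holomorphic parametric integral, ★ `differentiableOn_integral_of_dominated`); (c5) on `{2 < Re}`,
`E(flat(Pφ, z)) = P(E(flat(φ, z)))` — `flat ∘ P = P ∘ flat` by the height invariance, and the Eisenstein sum over `B(F)∖G(F)` commutes with `∫_K` by Fubini under the Godement majorant
made uniform on the compact orbit `x·ι(K)` (★ `exists_locallyUniform_majorant_flatSectionU_cm_three` + a finite subcover); (c6) the pole letter: with T's regularity on the slit
half-plane the extension `F(y, z) := (z − 3∕2)·Ec z y` (value `Fp y (3∕2)` at the centre) is holomorphic on a UNIFORM disc and jointly bounded on `compact × disc` (★ CT-RES's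
`differentiableOn_midPoleExtension` ∕ `norm_midPoleExtension_le`), so `Fp′ g z := P(F(·, z))(g)` is analytic at `3∕2`, equals `(z − 3∕2)·P(Ec z)(g)` off the centre, and
`Fp′ g (3∕2) = P(Fp(·)(3∕2))(g)` — the averaged residue function.
* §1 `isChiSectionPair_rightAverage`, `rightAverage_mul_level`, **`mem_chiSectionSpacePair_rightAverage`** (c1); **`continuous_rightAverage`** (c2); `flatSectionU_rightAverage` (flat ∘ P = P ∘ flat).
* §2 **`differentiableOn_rightAverage_family`** (c4).
* §3 `exists_summable_majorant_flatSectionU_orbit` (uniform Godement majorant on a compact orbit), **`eisensteinSeriesU_flatSectionU_rightAverage`** (c5).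
* §4 **`exists_midPoleLetter_rightAverage`** (c6): the averaged pole letter, analytic at `3∕2`, `=ᶠ (z − 3∕2)·P(Ec z)`, value `P(Fp(·)(3∕2))`.
* §5 **HEAD `admissible_rightAverage`** — D1's clause list for `(Pφ, P ∘ Ec, Sp, Fp′)` from D1's clauses for `(φ, Ec, Sp, Fp)` + T's `hE4`∕`hEbd` + the structure letters `hH`∕`hcomm`.
HONEST LABEL: HC_CM is proved only modulo the 7 printed citations (2 remaining named inputs: hLiu418 = `stmt-HodgeConjecture-24832`, h413 = `stmt-HodgeConjecture-24833`) until
rung 0 closes; REL ≠ ★ ≠ BUILT; (hstab) is paid here for REGULAR data only (T's `hE4`∕`hEbd` visible — ruling J-S8-W1: hW1 = hW1_reg + hW1_wild); the `L²`-class clause (Fubini on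
`X × K`) and `IsArchFinite (e_τ φ)` are NOT in this file; pays no socket; count-neutral.

## References
* [MoeglinWaldspurger1995] C. Mœglin, J.-L. Waldspurger, *Spectral Decomposition and Eisenstein Series* (1995), I.2.17, II.1.5–II.1.7, IV.1.9–IV.1.11.
* [BorelJacquet1979] A. Borel, H. Jacquet, *Automorphic forms and automorphic representations*, Proc. Sympos. Pure Math. 33.1 (1979), §1.3, §4.1.
* [Conway1978] J. B. Conway, *Functions of One Complex Variable*, 2nd ed., GTM 11 (1978), IV §3, §5.
-/

set_option autoImplicit false
set_option linter.dupNamespace false  -- the mandated namespace `…HodgeConjecture.HodgeConjecture.R90.S8` (LEAD #1 L1) repeats the summit's segment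

noncomputable section

open MeasureTheory Measure Set Filter Topology NumberField Metric
open Literature.NumberTheory Literature.NumberTheory.Automorphic Literature.NumberTheory.Automorphic.UnitaryGroup Literature.NumberTheory.GaloisRepresentations AdelicGroupData
open Literature.NumberTheory.Automorphic.Arthur2013.Leaves.TECR Literature.NumberTheory.Rogawski1990
open Summit.HodgeConjecture.HodgeConjecture.Cruxes.H413.K2E1BorelEisensteinU
open Summit.HodgeConjecture.HodgeConjecture.Cruxes.H413.K2E1CharacterEisensteinU3PairDefs
open Summit.HodgeConjecture.HodgeConjecture.Cruxes.H413.K2E1ChiSectionSpaceU3PairDefs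
open Summit.HodgeConjecture.HodgeConjecture.Cruxes.H413.K2E1BorelEisensteinGodementCMThree (exists_locallyUniform_majorant_flatSectionU_cm_three)
open Summit.HodgeConjecture.HodgeConjecture.Cruxes.H413.K2E1BorelEisensteinGodementU (countable_borelQuotient)
open scoped ENNReal NNReal

namespace Summit.HodgeConjecture.HodgeConjecture.R90.S8

variable (L : Type) [Field L] [NumberField L] [IsCMField L]
  {K : Type*} [TopologicalSpace K] [MeasurableSpace K] [OpensMeasurableSpace K] [CompactSpace K] (μK : Measure K) [IsFiniteMeasure μK]
  (ι : K → (quasiSplit (↥(maximalRealSubfield L)) L (IsCMField.complexConj L) 3).Adelic) (c : K → ℂ)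

/-! ## §1 The right average `(P F)(x) = ∫_K c(k)·F(x·ι k) dμ_K`: pair-section laws, continuity, flatness -/

omit [TopologicalSpace K] [OpensMeasurableSpace K] [CompactSpace K] [IsFiniteMeasure μK] in
/-- **(c1, left law) The right average of a `(χ₁, χ₂)`-pair section is a `(χ₁, χ₂)`-pair section** — the Borel law is a LEFT law, the average acts on the RIGHT (`integral_const_mul`).
[cite: MoeglinWaldspurger1995, I.2.17] -/
theorem isChiSectionPair_rightAverage {χ₁ : HeckeCharacter L} {χ₂ : ↥(TorusDict.torus (IsCMField.complexConj L)) →ₜ* ℂˣ}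
    {φ : (quasiSplit (↥(maximalRealSubfield L)) L (IsCMField.complexConj L) 3).Adelic → ℂ} (hφ : IsChiSectionPair (F := ↥(maximalRealSubfield L)) χ₁ χ₂ φ) :
    IsChiSectionPair (F := ↥(maximalRealSubfield L)) χ₁ χ₂ (fun x => ∫ k, c k * φ (x * ι k) ∂μK) := by
  intro b hb g
  show (∫ k, c k * φ (b * g * ι k) ∂μK) = _ * ∫ k, c k * φ (g * ι k) ∂μK
  rw [← integral_const_mul]
  refine integral_congr_ae (Eventually.of_forall fun k => ?_)
  simp only [mul_assoc b g, hφ.borel_mul hb (g * ι k)]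
  ring

omit [TopologicalSpace K] [OpensMeasurableSpace K] [CompactSpace K] [IsFiniteMeasure μK] in
/-- **(c1, right law) The right average keeps the right `(K′, ω)`-law WHEN `K′` COMMUTES WITH `ι(K)`** (★ `commute_tauLevel_archMaximalCompact` at τ-levels; false in general).
[cite: MoeglinWaldspurger1995, I.2.17] [cite: BorelJacquet1979, §4.1] -/
theorem rightAverage_mul_level {K' : Subgroup (quasiSplit (↥(maximalRealSubfield L)) L (IsCMField.complexConj L) 3).Adelic} {ω : ↥K' → ℂ}
    (hcomm : ∀ (k : K) (k' : ↥K'), ι k * (k' : (quasiSplit (↥(maximalRealSubfield L)) L (IsCMField.complexConj L) 3).Adelic) = (k' : (quasiSplit (↥(maximalRealSubfield L)) L (IsCMField.complexConj L) 3).Adelic) * ι k)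
    {φ : (quasiSplit (↥(maximalRealSubfield L)) L (IsCMField.complexConj L) 3).Adelic → ℂ}
    (hφK : ∀ (g : (quasiSplit (↥(maximalRealSubfield L)) L (IsCMField.complexConj L) 3).Adelic) (k' : ↥K'), φ (g * (k' : (quasiSplit (↥(maximalRealSubfield L)) L (IsCMField.complexConj L) 3).Adelic)) = ω k' * φ g)
    (g : (quasiSplit (↥(maximalRealSubfield L)) L (IsCMField.complexConj L) 3).Adelic) (k' : ↥K') :
    (∫ k, c k * φ (g * (k' : (quasiSplit (↥(maximalRealSubfield L)) L (IsCMField.complexConj L) 3).Adelic) * ι k) ∂μK) = ω k' * ∫ k, c k * φ (g * ι k) ∂μK := by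
  rw [← integral_const_mul]
  refine integral_congr_ae (Eventually.of_forall fun k => ?_)
  show c k * φ (g * (k' : (quasiSplit (↥(maximalRealSubfield L)) L (IsCMField.complexConj L) 3).Adelic) * ι k) = ω k' * (c k * φ (g * ι k))
  rw [mul_assoc g, ← hcomm k k', ← mul_assoc, hφK (g * ι k) k']
  ring

omit [TopologicalSpace K] [OpensMeasurableSpace K] [CompactSpace K] [IsFiniteMeasure μK] in
/-- **(c1) `P` MAPS `V(χ₁, χ₂; K′, ω)` TO ITSELF** when `K′` commutes with `ι(K)`. [cite: MoeglinWaldspurger1995, I.2.17] [cite: BorelJacquet1979, §4.1] -/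
theorem mem_chiSectionSpacePair_rightAverage {χ₁ : HeckeCharacter L} {χ₂ : ↥(TorusDict.torus (IsCMField.complexConj L)) →ₜ* ℂˣ}
    {K' : Subgroup (quasiSplit (↥(maximalRealSubfield L)) L (IsCMField.complexConj L) 3).Adelic} {ω : ↥K' → ℂ}
    (hcomm : ∀ (k : K) (k' : ↥K'), ι k * (k' : (quasiSplit (↥(maximalRealSubfield L)) L (IsCMField.complexConj L) 3).Adelic) = (k' : (quasiSplit (↥(maximalRealSubfield L)) L (IsCMField.complexConj L) 3).Adelic) * ι k)
    {φ : (quasiSplit (↥(maximalRealSubfield L)) L (IsCMField.complexConj L) 3).Adelic → ℂ} (hφV : φ ∈ chiSectionSpacePair χ₁ χ₂ K' ω) :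
    (fun x => ∫ k, c k * φ (x * ι k) ∂μK) ∈ chiSectionSpacePair χ₁ χ₂ K' ω :=
  mem_chiSectionSpacePair (isChiSectionPair_rightAverage L μK ι c (isChiSectionPair_of_mem hφV))
    fun g k' => rightAverage_mul_level L μK ι c hcomm (fun g k' => apply_mul_of_mem hφV g k') g k'

/-- **(c2) THE RIGHT AVERAGE OF A CONTINUOUS FUNCTION IS CONTINUOUS** (jointly continuous integrand on `G(𝔸) × K`, `K` compact, `μ_K` finite; `G(𝔸)` locally compact second countable ★;
Mathlib `continuous_parametric_integral_of_continuous`). [cite: BorelJacquet1979, §1.3] -/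
theorem continuous_rightAverage (hι : Continuous ι) (hc : Continuous c)
    {Φ : (quasiSplit (↥(maximalRealSubfield L)) L (IsCMField.complexConj L) 3).Adelic → ℂ} (hΦ : Continuous Φ) :
    Continuous fun x => ∫ k, c k * Φ (x * ι k) ∂μK := by
  haveI : LocallyCompactSpace (quasiSplit (↥(maximalRealSubfield L)) L (IsCMField.complexConj L) 3).Adelic :=
    locallyCompactSpace_cmDatum_Adelic L 3 ((StdForm.antidiagonal 3).over L)
  haveI : SecondCountableTopology (quasiSplit (↥(maximalRealSubfield L)) L (IsCMField.complexConj L) 3).Adelic :=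
    secondCountableTopology_cmDatum_Adelic L 3 ((StdForm.antidiagonal 3).over L)
  have hj : Continuous (Function.uncurry fun (x : (quasiSplit (↥(maximalRealSubfield L)) L (IsCMField.complexConj L) 3).Adelic) (k : K) => c k * Φ (x * ι k)) :=
    (hc.comp continuous_snd).mul (hΦ.comp (continuous_fst.mul (hι.comp continuous_snd)))
  have h := continuous_parametric_integral_of_continuous (μ := μK) hj isCompact_univ
  simp only [Measure.restrict_univ] at h
  exact h

omit [TopologicalSpace K] [OpensMeasurableSpace K] [CompactSpace K] [IsFiniteMeasure μK] in
/-- **`flat(Pφ, z) = P(flat(φ, z))`** when the height does not see `ι(K)` (`H(x·ι k) = H(x)`, ★ `borelHeight_mul_coe_archMaximalCompact` at `K_∞`): `(∫ c·φ(x ι k))·H(x)^z = ∫ c·φ(x ι k)·H(x ι k)^z`.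
[cite: MoeglinWaldspurger1995, II.1.5] -/
theorem flatSectionU_rightAverage (hH : ∀ (x : (quasiSplit (↥(maximalRealSubfield L)) L (IsCMField.complexConj L) 3).Adelic) (k : K), borelHeight (x * ι k) = borelHeight x)
    (φ : (quasiSplit (↥(maximalRealSubfield L)) L (IsCMField.complexConj L) 3).Adelic → ℂ) (z : ℂ) (x : (quasiSplit (↥(maximalRealSubfield L)) L (IsCMField.complexConj L) 3).Adelic) :
    flatSectionU (fun y => ∫ k, c k * φ (y * ι k) ∂μK) z x = ∫ k, c k * flatSectionU φ z (x * ι k) ∂μK := by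
  simp only [flatSectionU_apply, hH, ← mul_assoc]
  exact (integral_mul_const _ _).symm

/-! ## §2 (c4) Holomorphy of the averaged family -/

/-- **(c4) THE AVERAGED FAMILY IS HOLOMORPHIC**: for a family `Φ` holomorphic in `z ∈ U` (open) at every point, continuous in `g` at every `z ∈ U`, and jointly locally bounded (T's `hE4`∕`hEbd`
shapes), `z ↦ ∫_K c(k)·Φ z (g·ι k) dμ_K` is holomorphic on `U` — dominated holomorphic parametric integral over the finite measure `μ_K`, bound from the compact orbit `g·ι(K)` (the device of ★
`differentiableOn_borelConstantTerm_family` with `K` in place of `𝓕`). [cite: Conway1978, IV §3] [cite: MoeglinWaldspurger1995, IV.1.9] -/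
theorem differentiableOn_rightAverage_family (hι : Continuous ι) (hc : Continuous c)
    (Φ : ℂ → (quasiSplit (↥(maximalRealSubfield L)) L (IsCMField.complexConj L) 3).Adelic → ℂ) {U : Set ℂ} (hUo : IsOpen U)
    (hΦd : ∀ g, DifferentiableOn ℂ (fun z => Φ z g) U) (hΦc : ∀ z ∈ U, Continuous (Φ z))
    (hΦbd : ∀ z₀ ∈ U, ∀ S : Set (quasiSplit (↥(maximalRealSubfield L)) L (IsCMField.complexConj L) 3).Adelic, IsCompact S → ∃ V ∈ 𝓝 z₀, ∃ M : ℝ, ∀ z ∈ V, ∀ g ∈ S, ‖Φ z g‖ ≤ M)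
    (g : (quasiSplit (↥(maximalRealSubfield L)) L (IsCMField.complexConj L) 3).Adelic) :
    DifferentiableOn ℂ (fun z => ∫ k, c k * Φ z (g * ι k) ∂μK) U := by
  obtain ⟨C, hC⟩ := (isCompact_univ (X := K)).exists_bound_of_continuousOn hc.continuousOn
  have ha : Continuous fun k : K => g * ι k := continuous_const.mul hι
  refine Literature.Analysis.Complex.differentiableOn_integral_of_dominated (μ := μK)
    (F := fun z k => c k * Φ z (g * ι k)) (fun z hz => (hc.mul ((hΦc z hz).comp ha)).aestronglyMeasurable)
    (Eventually.of_forall fun k => (differentiableOn_const (c k)).mul (hΦd _)) fun z₀ hz₀ => ?_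
  obtain ⟨V, hV, M, hM⟩ := hΦbd z₀ hz₀ _ (isCompact_range ha)
  obtain ⟨R, hR, hRsub⟩ := Metric.mem_nhds_iff.1 (inter_mem hV (hUo.mem_nhds hz₀))
  refine ⟨R, hR, fun z hz => (hRsub hz).2, fun _ => C * M, integrable_const _, Eventually.of_forall fun k z hz => ?_⟩
  rw [norm_mul]
  have hM0 : 0 ≤ M := (norm_nonneg _).trans (hM z₀ (mem_of_mem_nhds hV) _ ⟨k, rfl⟩)
  exact mul_le_mul (hC k (mem_univ k)) (hM z (hRsub hz).1 _ ⟨k, rfl⟩) (norm_nonneg _) ((norm_nonneg _).trans (hC k (mem_univ k)))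

/-! ## §3 (c5) The Eisenstein sum commutes with the right average on `{2 < Re}` -/

omit [MeasurableSpace K] [OpensMeasurableSpace K] [IsFiniteMeasure μK] in
/-- **A SUMMABLE GODEMENT MAJORANT UNIFORM ON THE COMPACT ORBIT `x·ι(K)`** (`2 < Re z`, `‖φ‖ ≤ M`): the locally uniform majorants of ★ `exists_locallyUniform_majorant_flatSectionU_cm_three` at the
points of the compact orbit, summed over a finite subcover. [cite: MoeglinWaldspurger1995, II.1.5] [cite: Godement1964, §1.1] -/
theorem exists_summable_majorant_flatSectionU_orbit (hι : Continuous ι) {z : ℂ} (hz : 2 < z.re)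
    {φ : (quasiSplit (↥(maximalRealSubfield L)) L (IsCMField.complexConj L) 3).Adelic → ℂ} {M : ℝ} (hφM : ∀ x, ‖φ x‖ ≤ M)
    (x : (quasiSplit (↥(maximalRealSubfield L)) L (IsCMField.complexConj L) 3).Adelic) :
    ∃ u : Quotient (MulAction.orbitRel ↥(borelU ((IsCMField.complexConj L : L ≃ₐ[↥(maximalRealSubfield L)] L) : L →+* L) ((StdForm.antidiagonal 3).over L)) ↥(unitaryGroupOfForm ((IsCMField.complexConj L : L ≃ₐ[↥(maximalRealSubfield L)] L) : L →+* L) ((StdForm.antidiagonal 3).over L))) → ℝ,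
      Summable u ∧ ∀ (k : K) (q : Quotient (MulAction.orbitRel ↥(borelU ((IsCMField.complexConj L : L ≃ₐ[↥(maximalRealSubfield L)] L) : L →+* L) ((StdForm.antidiagonal 3).over L)) ↥(unitaryGroupOfForm ((IsCMField.complexConj L : L ≃ₐ[↥(maximalRealSubfield L)] L) : L →+* L) ((StdForm.antidiagonal 3).over L)))),
        ‖flatSectionU φ z ((quasiSplit (↥(maximalRealSubfield L)) L (IsCMField.complexConj L) 3).toAdelic (Quotient.out q : ↥(unitaryGroupOfForm ((IsCMField.complexConj L : L ≃ₐ[↥(maximalRealSubfield L)] L) : L →+* L) ((StdForm.antidiagonal 3).over L))) * (x * ι k))‖ ≤ u q := by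
  classical
  choose U hU u hu hmaj using fun g₀ : (quasiSplit (↥(maximalRealSubfield L)) L (IsCMField.complexConj L) 3).Adelic =>
    exists_locallyUniform_majorant_flatSectionU_cm_three L hz (φ := φ) (M := M) hφM g₀
  have hS : IsCompact (Set.range fun k : K => x * ι k) := isCompact_range (continuous_const.mul hι)
  obtain ⟨t, -, htcov⟩ := hS.elim_nhds_subcover U fun g₀ _ => hU g₀
  refine ⟨fun q => ∑ g₀ ∈ t, u g₀ q, summable_sum fun g₀ _ => hu g₀, fun k q => ?_⟩
  obtain ⟨g₀, hg₀t, hk⟩ : ∃ g₀ ∈ t, x * ι k ∈ U g₀ := by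
    have h := htcov ⟨k, rfl⟩
    simp only [Set.mem_iUnion, exists_prop] at h
    exact h
  refine (hmaj g₀ _ hk q).trans ?_
  show u g₀ q ≤ ∑ g₁ ∈ t, u g₁ q
  exact Finset.single_le_sum (f := fun g₁ => u g₁ q) (fun g₁ _ => (norm_nonneg _).trans (hmaj g₁ g₁ (mem_of_mem_nhds (hU g₁)) q)) hg₀t

/-- **(c5) `E(flat(Pφ, z))(x) = P(E(flat(φ, z)))(x)` FOR `2 < Re z`**: `flat ∘ P = P ∘ flat` (`H(x·ι k) = H(x)`), and the sum over `B(F)∖G(F)` (countable ★) commutes with `∫_K` by Fubini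
(Mathlib `integral_tsum`) under the uniform Godement majorant of the compact orbit (previous lemma) times `sup |c|`. [cite: MoeglinWaldspurger1995, II.1.5] [cite: BorelJacquet1979, §1.3] -/
theorem eisensteinSeriesU_flatSectionU_rightAverage (hι : Continuous ι) (hc : Continuous c)
    (hH : ∀ (x : (quasiSplit (↥(maximalRealSubfield L)) L (IsCMField.complexConj L) 3).Adelic) (k : K), borelHeight (x * ι k) = borelHeight x)
    {z : ℂ} (hz : 2 < z.re) {φ : (quasiSplit (↥(maximalRealSubfield L)) L (IsCMField.complexConj L) 3).Adelic → ℂ} (hφc : Continuous φ) {M : ℝ} (hφM : ∀ x, ‖φ x‖ ≤ M)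
    (x : (quasiSplit (↥(maximalRealSubfield L)) L (IsCMField.complexConj L) 3).Adelic) :
    eisensteinSeriesU (flatSectionU (fun y => ∫ k, c k * φ (y * ι k) ∂μK) z) x = ∫ k, c k * eisensteinSeriesU (flatSectionU φ z) (x * ι k) ∂μK := by
  classical
  haveI : Countable (Quotient (MulAction.orbitRel ↥(borelU ((IsCMField.complexConj L : L ≃ₐ[↥(maximalRealSubfield L)] L) : L →+* L) ((StdForm.antidiagonal 3).over L)) ↥(unitaryGroupOfForm ((IsCMField.complexConj L : L ≃ₐ[↥(maximalRealSubfield L)] L) : L →+* L) ((StdForm.antidiagonal 3).over L)))) :=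
    countable_borelQuotient
  obtain ⟨C, hC⟩ := (isCompact_univ (X := K)).exists_bound_of_continuousOn hc.continuousOn
  obtain ⟨u, hu, hmaj⟩ := exists_summable_majorant_flatSectionU_orbit L ι hι hz hφM x
  -- termwise: `flat(Pφ, z)(γ x) = ∫ c(k)·flat(φ, z)(γ x ι k)`
  have hterm : ∀ q : Quotient (MulAction.orbitRel ↥(borelU ((IsCMField.complexConj L : L ≃ₐ[↥(maximalRealSubfield L)] L) : L →+* L) ((StdForm.antidiagonal 3).over L)) ↥(unitaryGroupOfForm ((IsCMField.complexConj L : L ≃ₐ[↥(maximalRealSubfield L)] L) : L →+* L) ((StdForm.antidiagonal 3).over L))),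
      flatSectionU (fun y => ∫ k, c k * φ (y * ι k) ∂μK) z ((quasiSplit (↥(maximalRealSubfield L)) L (IsCMField.complexConj L) 3).toAdelic (Quotient.out q : ↥(unitaryGroupOfForm ((IsCMField.complexConj L : L ≃ₐ[↥(maximalRealSubfield L)] L) : L →+* L) ((StdForm.antidiagonal 3).over L))) * x) =
        ∫ k, c k * flatSectionU φ z ((quasiSplit (↥(maximalRealSubfield L)) L (IsCMField.complexConj L) 3).toAdelic (Quotient.out q : ↥(unitaryGroupOfForm ((IsCMField.complexConj L : L ≃ₐ[↥(maximalRealSubfield L)] L) : L →+* L) ((StdForm.antidiagonal 3).over L))) * (x * ι k)) ∂μK := fun q => by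
    rw [flatSectionU_rightAverage L μK ι c hH]
    simp only [mul_assoc]
  have hmeas : ∀ q : Quotient (MulAction.orbitRel ↥(borelU ((IsCMField.complexConj L : L ≃ₐ[↥(maximalRealSubfield L)] L) : L →+* L) ((StdForm.antidiagonal 3).over L)) ↥(unitaryGroupOfForm ((IsCMField.complexConj L : L ≃ₐ[↥(maximalRealSubfield L)] L) : L →+* L) ((StdForm.antidiagonal 3).over L))),
      AEStronglyMeasurable (fun k : K => c k * flatSectionU φ z ((quasiSplit (↥(maximalRealSubfield L)) L (IsCMField.complexConj L) 3).toAdelic (Quotient.out q : ↥(unitaryGroupOfForm ((IsCMField.complexConj L : L ≃ₐ[↥(maximalRealSubfield L)] L) : L →+* L) ((StdForm.antidiagonal 3).over L))) * (x * ι k))) μK := fun q =>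
    (hc.mul ((continuous_flatSectionU hφc z).comp (continuous_const.mul (continuous_const.mul hι)))).aestronglyMeasurable
  have hfin : ∑' q : Quotient (MulAction.orbitRel ↥(borelU ((IsCMField.complexConj L : L ≃ₐ[↥(maximalRealSubfield L)] L) : L →+* L) ((StdForm.antidiagonal 3).over L)) ↥(unitaryGroupOfForm ((IsCMField.complexConj L : L ≃ₐ[↥(maximalRealSubfield L)] L) : L →+* L) ((StdForm.antidiagonal 3).over L))),
      ∫⁻ k, ‖c k * flatSectionU φ z ((quasiSplit (↥(maximalRealSubfield L)) L (IsCMField.complexConj L) 3).toAdelic (Quotient.out q : ↥(unitaryGroupOfForm ((IsCMField.complexConj L : L ≃ₐ[↥(maximalRealSubfield L)] L) : L →+* L) ((StdForm.antidiagonal 3).over L))) * (x * ι k))‖ₑ ∂μK ≠ ∞ := by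
    have hC0 : 0 ≤ max C 0 := le_max_right _ _
    have hle : ∀ q : Quotient (MulAction.orbitRel ↥(borelU ((IsCMField.complexConj L : L ≃ₐ[↥(maximalRealSubfield L)] L) : L →+* L) ((StdForm.antidiagonal 3).over L)) ↥(unitaryGroupOfForm ((IsCMField.complexConj L : L ≃ₐ[↥(maximalRealSubfield L)] L) : L →+* L) ((StdForm.antidiagonal 3).over L))),
        ∫⁻ k, ‖c k * flatSectionU φ z ((quasiSplit (↥(maximalRealSubfield L)) L (IsCMField.complexConj L) 3).toAdelic (Quotient.out q : ↥(unitaryGroupOfForm ((IsCMField.complexConj L : L ≃ₐ[↥(maximalRealSubfield L)] L) : L →+* L) ((StdForm.antidiagonal 3).over L))) * (x * ι k))‖ₑ ∂μK ≤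
          ENNReal.ofReal (max C 0 * |u q|) * μK Set.univ := fun q => by
      rw [← lintegral_const]
      refine lintegral_mono fun k => ?_
      rw [← ofReal_norm, norm_mul]
      exact ENNReal.ofReal_le_ofReal (mul_le_mul ((hC k (mem_univ k)).trans (le_max_left _ _)) ((hmaj k q).trans (le_abs_self _)) (norm_nonneg _) hC0)
    refine ne_top_of_le_ne_top ?_ (ENNReal.tsum_le_tsum hle)
    rw [ENNReal.tsum_mul_right, ← ENNReal.ofReal_tsum_of_nonneg (fun q => mul_nonneg hC0 (abs_nonneg _)) (hu.abs.mul_left _)]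
    exact ENNReal.mul_ne_top ENNReal.ofReal_ne_top (measure_ne_top _ _)
  simp only [eisensteinSeriesU_def, hterm]
  rw [← integral_tsum hmeas hfin]
  refine integral_congr_ae (Eventually.of_forall fun k => ?_)
  exact tsum_mul_left

/-! ## §4 (c6) The averaged pole letter at `3∕2` -/

/-- **(c6) THE AVERAGED POLE LETTER.**  From D1's pole letter `(Fp, hFp, hFpE)` at `3∕2` of a family `Ec` holomorphic on the slit half-plane `{1 < Re} ∖ Sp` with T's regularity there (`hE4`
continuity, `hEbd` joint local bound): there is `Fp′` with `Fp′ g` ANALYTIC at `3∕2`, `Fp′ g = (z − 3∕2)·P(Ec z)(g)` near `3∕2` (punctured), and `Fp′ g (3∕2) = P(Fp(·)(3∕2))(g)` — the AVERAGED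
RESIDUE FUNCTION.  Device: ★ CT-RES's uniform disc (`differentiableOn_midPoleExtension`, `norm_midPoleExtension_le`, `continuous_midPoleLetter_apply`) at `P := ({1 < Re} ∖ Sp)ᶜ` (the slit
half-plane is a punctured neighbourhood of `3∕2`, ★ `reSlit_mem_nhdsNE_three_halves`), then §2. [cite: Conway1978, IV §3, §5] [cite: MoeglinWaldspurger1995, IV.1.9–IV.1.11] -/
theorem exists_midPoleLetter_rightAverage (hι : Continuous ι) (hc : Continuous c)
    (Ec : ℂ → (quasiSplit (↥(maximalRealSubfield L)) L (IsCMField.complexConj L) 3).Adelic → ℂ) (Sp : Finset ℂ)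
    (hol : ∀ g, DifferentiableOn ℂ (fun z => Ec z g) ({z : ℂ | 1 < z.re} \ (↑Sp : Set ℂ)))
    (hE4 : ∀ z ∈ ({z : ℂ | 1 < z.re} \ (↑Sp : Set ℂ)), Continuous (Ec z))
    (hEbd : ∀ z₁ ∈ ({z : ℂ | 1 < z.re} \ (↑Sp : Set ℂ)), ∀ S : Set (quasiSplit (↥(maximalRealSubfield L)) L (IsCMField.complexConj L) 3).Adelic, IsCompact S → ∃ V ∈ 𝓝 z₁, ∃ M : ℝ, ∀ z ∈ V, ∀ g ∈ S, ‖Ec z g‖ ≤ M)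
    (Fp : (quasiSplit (↥(maximalRealSubfield L)) L (IsCMField.complexConj L) 3).Adelic → ℂ → ℂ) (hFp : ∀ g, AnalyticAt ℂ (Fp g) ((3 : ℂ) / 2))
    (hFpE : ∀ g, Fp g =ᶠ[𝓝[≠] ((3 : ℂ) / 2)] fun z => (z - (3 : ℂ) / 2) * Ec z g) :
    ∃ Fp' : (quasiSplit (↥(maximalRealSubfield L)) L (IsCMField.complexConj L) 3).Adelic → ℂ → ℂ,
      (∀ g, AnalyticAt ℂ (Fp' g) ((3 : ℂ) / 2)) ∧
      (∀ g, Fp' g =ᶠ[𝓝[≠] ((3 : ℂ) / 2)] fun z => (z - (3 : ℂ) / 2) * ∫ k, c k * Ec z (g * ι k) ∂μK) ∧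
      ∀ g, Fp' g ((3 : ℂ) / 2) = ∫ k, c k * Fp (g * ι k) ((3 : ℂ) / 2) ∂μK := by
  set z₀ : ℂ := (3 : ℂ) / 2 with hz₀
  -- the slit half-plane in ★ CT-RES's `P`-currency
  set P : Set ℂ := ({z : ℂ | 1 < z.re} \ (↑Sp : Set ℂ))ᶜ with hPdef
  have hPiff : ∀ z : ℂ, z ∉ P ↔ z ∈ ({z : ℂ | 1 < z.re} \ (↑Sp : Set ℂ)) := fun z => by rw [hPdef, Set.mem_compl_iff, not_not]
  have hopen : IsOpen ({z : ℂ | 1 < z.re} \ (↑Sp : Set ℂ)) := (isOpen_lt continuous_const Complex.continuous_re).sdiff Sp.finite_toSet.isClosed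
  have hPdisc : ∀ᶠ s in 𝓝[≠] z₀, s ∉ P := by
    filter_upwards [reSlit_mem_nhdsNE_three_halves Sp] with s hs
    exact (hPiff s).2 hs
  have hEcA : ∀ g (z : ℂ), z ∉ P → AnalyticAt ℂ (fun z => Ec z g) z := fun g z hz => (hol g).analyticAt (hopen.mem_nhds ((hPiff z).1 hz))
  have hEcc : ∀ z : ℂ, z ∉ P → Continuous (Ec z) := fun z hz => hE4 z ((hPiff z).1 hz)
  have hE2bd : ∀ z₁ : ℂ, z₁ ∉ P → ∀ S : Set (quasiSplit (↥(maximalRealSubfield L)) L (IsCMField.complexConj L) 3).Adelic, IsCompact S → ∃ V ∈ 𝓝 z₁, ∃ M : ℝ, ∀ z ∈ V, ∀ g ∈ S, ‖Ec z g‖ ≤ M :=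
    fun z₁ hz₁ => hEbd z₁ ((hPiff z₁).1 hz₁)
  obtain ⟨r₀, hr₀, hP⟩ : ∃ r₀ > 0, ∀ s : ℂ, dist s z₀ < r₀ → s ≠ z₀ → s ∉ P := by
    obtain ⟨ε, hε, h⟩ := Metric.eventually_nhds_iff.1 (eventually_nhdsWithin_iff.1 hPdisc)
    exact ⟨ε, hε, fun s hs hne => h hs hne⟩
  -- ★ CT-RES's extension on the uniform disc
  set F : (quasiSplit (↥(maximalRealSubfield L)) L (IsCMField.complexConj L) 3).Adelic → ℂ → ℂ :=
    fun y => Function.update (fun z => (z - z₀) * Ec z y) z₀ (Fp y z₀) with hF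
  have hFdiff : ∀ y, DifferentiableOn ℂ (F y) (ball z₀ r₀) := differentiableOn_midPoleExtension Ec P Fp z₀ hP hEcA hFp hFpE
  have hFne : ∀ y (z : ℂ), z ≠ z₀ → F y z = (z - z₀) * Ec z y := fun y z hz => by
    simp only [hF]
    exact Function.update_of_ne hz _ _
  have hFz₀ : ∀ y, F y z₀ = Fp y z₀ := fun y => by
    simp only [hF]
    exact Function.update_self _ _ _
  -- continuity in `y` on the disc: off the centre by `hE4`, at the centre ★ `continuous_midPoleLetter_apply`
  have hFc : ∀ z ∈ ball z₀ r₀, Continuous fun y => F y z := by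
    intro z hz
    by_cases hzz : z = z₀
    · rw [hzz]
      simp only [hFz₀]
      exact continuous_midPoleLetter_apply L Ec P hPdisc hEcA hEcc hE2bd Fp hFp hFpE
    · simp only [hFne _ z hzz]
      exact continuous_const.mul (hEcc z (hP z (mem_ball.1 hz) hzz))
  -- joint local bound on the disc (maximum modulus ★ `norm_midPoleExtension_le` on a slightly larger circle)
  have hFbd : ∀ z₁ ∈ ball z₀ r₀, ∀ S : Set (quasiSplit (↥(maximalRealSubfield L)) L (IsCMField.complexConj L) 3).Adelic, IsCompact S →
      ∃ V ∈ 𝓝 z₁, ∃ M : ℝ, ∀ z ∈ V, ∀ y ∈ S, ‖(fun z y => F y z) z y‖ ≤ M := by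
    intro z₁ hz₁ S hS
    obtain ⟨r, hz₁r, hrr₀⟩ := exists_between (mem_ball.1 hz₁)
    have hrpos : 0 < r := lt_of_le_of_lt dist_nonneg hz₁r
    obtain ⟨M, -, hM⟩ := exists_uniform_bound_of_locally_bounded (isCompact_sphere z₀ r) S Ec fun w hw => by
      refine hE2bd w (hP w ?_ ?_) S hS
      · rw [mem_sphere] at hw
        rw [hw]; exact hrr₀
      · intro h
        rw [h, mem_sphere, dist_self] at hw
        exact hrpos.ne' hw.symm
    exact ⟨ball z₀ r, isOpen_ball.mem_nhds (mem_ball.2 hz₁r), r * M, fun z hz y hy =>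
      norm_midPoleExtension_le Ec P Fp z₀ hP hEcA hFp hFpE hrpos hrr₀ hM hy (ball_subset_closedBall hz)⟩
  -- the averaged pole letter
  refine ⟨fun g z => ∫ k, c k * F (g * ι k) z ∂μK, fun g => ?_, fun g => ?_, fun g => ?_⟩
  · have hd := differentiableOn_rightAverage_family L μK ι c hι hc (fun z y => F y z) isOpen_ball (fun y => hFdiff y) hFc hFbd g
    exact hd.analyticAt (ball_mem_nhds z₀ hr₀)
  · filter_upwards [self_mem_nhdsWithin] with z hz
    show (∫ k, c k * F (g * ι k) z ∂μK) = (z - z₀) * ∫ k, c k * Ec z (g * ι k) ∂μK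
    rw [← integral_const_mul]
    refine integral_congr_ae (Eventually.of_forall fun k => ?_)
    show c k * F (g * ι k) z = (z - z₀) * (c k * Ec z (g * ι k))
    rw [hFne _ z hz]
    ring
  · show (∫ k, c k * F (g * ι k) z₀ ∂μK) = ∫ k, c k * Fp (g * ι k) z₀ ∂μK
    simp only [hFz₀]

/-! ## §5 HEAD: the averaged datum is admissible (D1's clause list), for REGULAR data -/

/-- **(hstab) FOR REGULAR DATA — RIGHT `K`-AVERAGING PRESERVES ADMISSIBLE RESIDUE DATA.**  INPUT: ★ D1 `resGMidAtomGen ξ μω K′ ω`'s clauses for `(φ, Ec, Sp, Fp)` (`φ ∈ V(ξ.bcη⁻¹·ξ.bcψ⁻¹·μω,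
ξ.ψ; K′, ω)` continuous, `Ec` holomorphic on `{1 < Re} ∖ Sp` and `= E(flat(φ, ·))` on `{2 < Re}`, pole letter `(Fp, hFp, hFpE)` at `3∕2`), `μω` unitary (D1's sections are then bounded ★),
ESTATE T's regularity exports on the slit half-plane (`hE4`, `hEbd` — VISIBLE: ruling J-S8-W1, hW1 = hW1_reg + hW1_wild), and the structure letters of the averaging family `(K, μ_K, ι, c)`:
`K` compact, `μ_K` finite, `ι`, `c` continuous, `hH : H(x·ι k) = H(x)` (★ `borelHeight_mul_coe_archMaximalCompact` at `K_∞`), `hcomm : ι k·k′ = k′·ι k` on `K′` (★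
`commute_tauLevel_archMaximalCompact` at τ-levels).  OUTPUT: D1's clause list for the AVERAGED datum `(Pφ, P ∘ Ec, Sp, Fp′)`: `Pφ ∈ V(…; K′, ω)` and continuous; `z ↦ P(Ec z)(g)`
holomorphic on `{1 < Re} ∖ Sp`; `P(Ec z) = E(flat(Pφ, z))` for `2 < Re z`; `Fp′ g` analytic at `3∕2`, `=ᶠ (z − 3∕2)·P(Ec z)(g)`, and `Fp′ g (3∕2) = P(Fp(·)(3∕2))(g)`.  At `c = d_τ·conj χ_τ`,
`μ_K` = Haar probability of `K_∞`: «`e_τ` of an admissible regular datum is admissible». [cite: MoeglinWaldspurger1995, I.2.17, II.1.5–II.1.7, IV.1.9–IV.1.11] [cite: BorelJacquet1979, §1.3, §4.1] -/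
theorem admissible_rightAverage (hι : Continuous ι) (hc : Continuous c)
    (hH : ∀ (x : (quasiSplit (↥(maximalRealSubfield L)) L (IsCMField.complexConj L) 3).Adelic) (k : K), borelHeight (x * ι k) = borelHeight x)
    (ξ : OneDimAutRepH L) {μω : HeckeCharacter L} (hμω : μω.IsUnitary)
    {K' : Subgroup (quasiSplit (↥(maximalRealSubfield L)) L (IsCMField.complexConj L) 3).Adelic} {ω : ↥K' → ℂ}
    (hcomm : ∀ (k : K) (k' : ↥K'), ι k * (k' : (quasiSplit (↥(maximalRealSubfield L)) L (IsCMField.complexConj L) 3).Adelic) = (k' : (quasiSplit (↥(maximalRealSubfield L)) L (IsCMField.complexConj L) 3).Adelic) * ι k)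
    {φ : (quasiSplit (↥(maximalRealSubfield L)) L (IsCMField.complexConj L) 3).Adelic → ℂ} (hφV : φ ∈ chiSectionSpacePair (ξ.bcη⁻¹ * ξ.bcψ⁻¹ * μω) ξ.ψ K' ω) (hφc : Continuous φ)
    (Ec : ℂ → (quasiSplit (↥(maximalRealSubfield L)) L (IsCMField.complexConj L) 3).Adelic → ℂ) (Sp : Finset ℂ)
    (hol : ∀ g, DifferentiableOn ℂ (fun z => Ec z g) ({z : ℂ | 1 < z.re} \ (↑Sp : Set ℂ)))
    (hE4 : ∀ z ∈ ({z : ℂ | 1 < z.re} \ (↑Sp : Set ℂ)), Continuous (Ec z))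
    (hEbd : ∀ z₁ ∈ ({z : ℂ | 1 < z.re} \ (↑Sp : Set ℂ)), ∀ S : Set (quasiSplit (↥(maximalRealSubfield L)) L (IsCMField.complexConj L) 3).Adelic, IsCompact S → ∃ V ∈ 𝓝 z₁, ∃ M : ℝ, ∀ z ∈ V, ∀ g ∈ S, ‖Ec z g‖ ≤ M)
    (hEc2 : ∀ z : ℂ, 2 < z.re → Ec z = eisensteinSeriesU (flatSectionU φ z))
    (Fp : (quasiSplit (↥(maximalRealSubfield L)) L (IsCMField.complexConj L) 3).Adelic → ℂ → ℂ) (hFp : ∀ g, AnalyticAt ℂ (Fp g) ((3 : ℂ) / 2))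
    (hFpE : ∀ g, Fp g =ᶠ[𝓝[≠] ((3 : ℂ) / 2)] fun z => (z - (3 : ℂ) / 2) * Ec z g) :
    (fun x => ∫ k, c k * φ (x * ι k) ∂μK) ∈ chiSectionSpacePair (ξ.bcη⁻¹ * ξ.bcψ⁻¹ * μω) ξ.ψ K' ω ∧
    Continuous (fun x => ∫ k, c k * φ (x * ι k) ∂μK) ∧
    (∀ g, DifferentiableOn ℂ (fun z => ∫ k, c k * Ec z (g * ι k) ∂μK) ({z : ℂ | 1 < z.re} \ (↑Sp : Set ℂ))) ∧
    (∀ z : ℂ, 2 < z.re → (fun g => ∫ k, c k * Ec z (g * ι k) ∂μK) = eisensteinSeriesU (flatSectionU (fun x => ∫ k, c k * φ (x * ι k) ∂μK) z)) ∧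
    ∃ Fp' : (quasiSplit (↥(maximalRealSubfield L)) L (IsCMField.complexConj L) 3).Adelic → ℂ → ℂ,
      (∀ g, AnalyticAt ℂ (Fp' g) ((3 : ℂ) / 2)) ∧
      (∀ g, Fp' g =ᶠ[𝓝[≠] ((3 : ℂ) / 2)] fun z => (z - (3 : ℂ) / 2) * ∫ k, c k * Ec z (g * ι k) ∂μK) ∧
      ∀ g, Fp' g ((3 : ℂ) / 2) = ∫ k, c k * Fp (g * ι k) ((3 : ℂ) / 2) ∂μK := by
  obtain ⟨M, hφM⟩ := exists_bound_of_mem_chiSectionSpacePair_midBlock L ξ hμω hφV hφc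
  refine ⟨mem_chiSectionSpacePair_rightAverage L μK ι c hcomm hφV, continuous_rightAverage L μK ι c hι hc hφc,
    fun g => differentiableOn_rightAverage_family L μK ι c hι hc Ec ((isOpen_lt continuous_const Complex.continuous_re).sdiff Sp.finite_toSet.isClosed) hol hE4 hEbd g,
    fun z hz => ?_, exists_midPoleLetter_rightAverage L μK ι c hι hc Ec Sp hol hE4 hEbd Fp hFp hFpE⟩
  funext g
  rw [hEc2 z hz]
  exact (eisensteinSeriesU_flatSectionU_rightAverage L μK ι c hι hc hH hz hφc hφM g).symm

end Summit.HodgeConjecture.HodgeConjecture.R90.S8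

end
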